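import Summits.QuantumFields.BalabanUV.Beta.EriceRemainderEnclosureHistoryAutonomyContinuity

/-!
# EriceRemainderEnclosureHistoryAutonomyThresholdModulus — (E47a) THE MODULUS OF CONTINUITY ACROSS THE AUTONOMY THRESHOLD: under the
# CLOSED condition `M·γ ≤ 3√3·b` two box solutions `h, h′` of the flows with memory of `(B, g_IR)` and `(B′, g_IR′)` (zeroth moment `M` for
# `B`, common floor `b > 0` on ]0,γ], `|B − B′| ≤ η` on the box, pins in ]0,γ]) satisfy, at EVERY scale and with `q = M·γ∕(3√3·b)`,
# `F = γ³∕2·|1∕g_IR² − 1∕g_IR′²| + γ∕(3√3·b)·η`:   **`(1 − q)·|h_j − h′_j| + q·|h_j − h′_j|²∕γ ≤ F`**.   Below the threshold the linear term is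
# (E38b)'s Lipschitz modulus `F∕(1 − q)`; AT the threshold (`q = 1`, where that constant is infinite and (E40) had continuity WITHOUT a rate)
# the quadratic term survives: **`sup_j |h_j − h′_j| ≤ √(γ·F)`** — the solution depends `1∕2`-HÖLDER on the pin and on the functional; uniformly
# on the closed range: `sup_j |h_j − h′_j| ≤ 2F + √(2γF)`; ABOVE the threshold the width of the solution set of one flow is `≤ γ(1 − 1∕q)` and for every
# ratio `sup_j |h_j − h′_j| ≤ γ(1 − 1∕q)₊ + √(γF∕q)`.  (E47b) `…ThresholdModulusWitness` shows both terms of the modulus are EXACT in order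

Cell `pub-balaban`, β-function sub-cell, BINDER row D4 «RemainderConst leaves for Bałaban's split» (`HOME/BINDER-OWNERS.md`; owner lineage `b2b-balaban-beta-an4`;
this file by co-owner #2 lineage `b2b-balaban-beta-d4-p2`, generation 42), β-FLOW TEAM duty (1), FREEZE (0) honoured (def-free; node U2's `MemFlow` ∕ `drive` ∕
`SeqBox`, (E37b)'s `abs_drive_sub_drive_le_zm`, (E38a)'s `weight_sharp_le` ∕ `inv_sqrt_le_of_inv_sq_le`, (E40)'s `le_envelope_of_memFlow` ∕ `invSqrt_tail_le` BY
NAME, nothing restated).  Sequel of (E38a) `…HistoryAutonomyThreshold` (uniqueness under the CLOSED condition by the STRICT sensitivity), (E38b)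
`…HistoryAutonomyThresholdWellPosed` (`memFlow_stability_zs`: Lipschitz modulus `F∕(1−q)` under the OPEN condition) and (E40) `…HistoryAutonomyContinuity`
(continuous dependence WITHOUT a rate at every point of uniqueness).  Answers the lineage's open census question (E44d) «a MODULUS of continuity at `q = 1`».

HONEST FRAMING (page 1, verbatim and binding).  *"Discharging BetaPertH makes Bałaban's UV stability UNCONDITIONAL — a real constructive-QFT result; it is
NOT the continuum limit and NOT the Clay problem."*  THIS FILE DISCHARGES NOTHING OF THE KIND.  Pure real analysis about an ABSTRACT functional `B : (ℕ → ℝ) → ℝ`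
with displayed zeroth moment `M` and floor `b` on the box ]0,γ]^ℕ — hypotheses, not facts; which modulus Bałaban's limit functional has, and on which side of
the threshold it sits, is NOT PRINTED ([I] p. 298: the dependence on the preceding couplings exists, qualitatively; GAPS G-t4-U2-1∕-2) and not asserted.
Row D4 class UNCHANGED (critical-path width 0; instance 0∕1; D4 DISCHARGE NO DATE).  HONEST DEPENDENCY: continuum YM on T⁴ ⇐ BetaPertH ∧ nine spine
estimates (0/9 proved); BetaPertH ⇐ (D1) ∧ (D4) ∧ CAP+tail; G-an2-4 gates asym, D1 and NE2/3/4.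

THE POINT (census sense (α); the AUTONOMY row, its modulus).  (E38a) closed the threshold by the STRICT sensitivity `|a − a′| < C³∕2·|1∕a² − 1∕a′²|` (`a ≠ a′` in
]0,C]): uniqueness at `q = 1`, no rate.  §1 makes it QUANTITATIVE — the defect is LINEAR in the discrepancy: `|a − a′| ≤ C²·(C − |a − a′|)∕2·|1∕a² − 1∕a′²|`
(`2a²a′² ≤ C²(C − a + a′)(a + a′)` for `a′ ≤ a ≤ C`).  §2 runs (E38a)'s chain at the scale `j⋆` where `Δ = sup_j |h_j − h′_j|` is ATTAINED (the envelopes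
`(1∕γ² + j·b)^{−1∕2} → 0` make the supremum a maximum): `Δ ≤ (1 − Δ∕C_{j⋆})·(F + q·Δ)`, and `C_{j⋆} ≤ γ` gives `(1 − q)·Δ + q·Δ²∕γ ≤ F` — for EVERY `q ≥ 0`
(`exists_max_two_term`; no size condition), at every scale for `q ≤ 1` (§3 `two_term_modulus_zs_closed`).  §3 reads it: `q < 1` — drop the square: (E38b)'s
`F∕(1 − q)` (not restated); `0 < q ≤ 1` — drop the linear term: `|h_j − h′_j| ≤ √((3√3·b∕M)·F)`, `= √(γ·F)` AT the threshold; on `q ∈ [0,1]` uniformly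
`|h_j − h′_j| ≤ 2F + √(2γF)` (in the pin alone `≤ γ³·P + γ²·√P`, `P = |1∕g_IR² − 1∕g_IR′²|`; in the functional alone `≤ 2γη∕(3√3b) + √(2γ²η∕(3√3b))`; both
spelled out in (E47c)).  §4 ABOVE the threshold the same inequality bounds the WIDTH of the solution set of ONE flow: `sup_j |h_j − h′_j| ≤ γ(1 − 1∕q)`
(`abs_sub_le_width_above`) — (E44)'s compact line set shrinks to a point CONTINUOUSLY as `q ↓ 1`, at most linearly, the order of (E38c)'s ∕ (E45a)'s
witnesses — and for two flows of ANY ratio `sup_j |h_j − h′_j| ≤ γ(1 − 1∕q)₊ + √(γF∕q)` (`abs_sub_le_usc_modulus`): (E40)'s upper semicontinuity quantified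
everywhere.  So the AUTONOMY row's well-posedness on the closed range is complete WITH RATES — existence ((E40) `exists_memFlow_zm`), uniqueness ((E38a)),
the explicit modulus `min{F∕(1−q), √(γF∕q)}` (Lipschitz inside, `1∕2`-Hölder at the endpoint, crossover at `F ≍ γ(1−q)²∕q`) — and (E47b) pins both regimes
from below on a kink family at `bγ² = 2`; the sequential form (`TendstoUniformly`, with a rate) is (E47c)'s.  NOT claimed: anything about Bałaban's (1.22).

WHAT IS PROVED ([folklore]; 0 `def`, 0 sorry).  §1 `two_mul_sq_mul_sq_le`, **`abs_sub_le_defect_mul`**.  §2 `forcing_nonneg`, **`exists_max_two_term`**,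
`le_of_quadratic_step`.  §3 **`two_term_modulus_zs_closed`**, **`abs_sub_le_sqrt_zs_closed`**, **`abs_sub_le_sqrt_at_threshold`**, **`abs_sub_le_two_regime`**.
§4 **`abs_sub_le_usc_modulus`**, **`abs_sub_le_width_above`**.
-/

noncomputable section
open Filter Topology Finset

namespace Summit.QuantumFields.BalabanUV.Beta.EriceRemainderEnclosureHistoryAutonomyThresholdModulus

open Literature.MathematicalPhysics.QuantumFieldTheory.Balaban1983to89
open Literature.MathematicalPhysics.QuantumFieldTheory.Balaban1983to89.T4BetaStationary
open Literature.MathematicalPhysics.QuantumFieldTheory.Balaban1983to89.T4BetaFlowWellPosed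
open Summit.QuantumFields.BalabanUV.Beta.EriceRemainderEnclosureHistoryAutonomyWellPosed
open Summit.QuantumFields.BalabanUV.Beta.EriceRemainderEnclosureHistoryAutonomyThreshold
open Summit.QuantumFields.BalabanUV.Beta.EriceRemainderEnclosureHistoryAutonomyContinuity
  (le_envelope_of_memFlow invSqrt_tail_le)

variable {B B' : (ℕ → ℝ) → ℝ} {M γ b η gIR gIR' : ℝ} {h h' : ℕ → ℝ}

/-! ## §1 The effective sensitivity: the defect of the half-cube constant is linear in the discrepancy -/

/-- The polynomial core: `0 < a′ ≤ a ≤ C` ⟹ `2·a²·a′² ≤ C²·(C − (a − a′))·(a + a′)` (`2a′ ≤ a + a′`, and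
`C²(C − a + a′) − a²a′ = (C − a)(C² + a′(C + a)) ≥ 0`). [folklore] -/
theorem two_mul_sq_mul_sq_le {a a' C : ℝ} (ha' : 0 < a') (hle : a' ≤ a) (haC : a ≤ C) :
    2 * (a ^ 2 * a' ^ 2) ≤ C ^ 2 * (C - (a - a')) * (a + a') := by
  have ha : 0 < a := ha'.trans_le hle
  have hC : 0 ≤ C := ha.le.trans haC
  have h1 : 2 * (a ^ 2 * a' ^ 2) ≤ (a + a') * (a ^ 2 * a') := by
    nlinarith [mul_nonneg (mul_nonneg (sq_nonneg a) ha'.le) (sub_nonneg.2 hle)]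
  have h2 : a ^ 2 * a' ≤ C ^ 2 * (C - (a - a')) := by
    have e : C ^ 2 * (C - (a - a')) - a ^ 2 * a' = (C - a) * (C ^ 2 + a' * (C + a)) := by ring
    nlinarith [mul_nonneg (sub_nonneg.2 haC) (by positivity : (0 : ℝ) ≤ C ^ 2 + a' * (C + a))]
  calc 2 * (a ^ 2 * a' ^ 2) ≤ (a + a') * (a ^ 2 * a') := h1
    _ ≤ (a + a') * (C ^ 2 * (C - (a - a'))) := mul_le_mul_of_nonneg_left h2 (by positivity)
    _ = C ^ 2 * (C - (a - a')) * (a + a') := by ring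

/-- **THE EFFECTIVE SENSITIVITY.**  For `a, a′ ∈ ]0, C]`:  `|a − a′| ≤ C²·(C − |a − a′|)∕2 · |1∕a² − 1∕a′²|` — node U2's half-cube constant `C³∕2`
(`Sharpness.abs_sub_le_half_cube_mul`) improved by the factor `1 − |a − a′|∕C`: the defect is LINEAR in the discrepancy ((E38a)'s strict form
`abs_sub_lt_half_cube_mul` made quantitative). [folklore] -/
theorem abs_sub_le_defect_mul {a a' C : ℝ} (ha : 0 < a) (ha' : 0 < a') (haC : a ≤ C) (ha'C : a' ≤ C) :
    |a - a'| ≤ C ^ 2 * (C - |a - a'|) / 2 * |1 / a ^ 2 - 1 / a' ^ 2| := by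
  wlog hle : a' ≤ a generalizing a a'
  · have := this ha' ha ha'C haC (le_of_not_ge hle)
    rwa [abs_sub_comm a' a, abs_sub_comm (1 / a' ^ 2) (1 / a ^ 2)] at this
  have e : 1 / a ^ 2 - 1 / a' ^ 2 = -((a - a') * ((a + a') / (a ^ 2 * a' ^ 2))) := by
    field_simp
    ring
  have hd : |a - a'| = a - a' := abs_of_nonneg (sub_nonneg.2 hle)
  rw [e, abs_neg, abs_mul, abs_of_pos (by positivity : 0 < (a + a') / (a ^ 2 * a' ^ 2)), hd]
  have hpoly := two_mul_sq_mul_sq_le ha' hle haC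
  have hK : 1 ≤ C ^ 2 * (C - (a - a')) / 2 * ((a + a') / (a ^ 2 * a' ^ 2)) := by
    rw [show C ^ 2 * (C - (a - a')) / 2 * ((a + a') / (a ^ 2 * a' ^ 2))
        = C ^ 2 * (C - (a - a')) * (a + a') / (2 * (a ^ 2 * a' ^ 2)) by ring,
      le_div_iff₀ (by positivity), one_mul]
    exact hpoly
  calc a - a' = (a - a') * 1 := (mul_one _).symm
    _ ≤ (a - a') * (C ^ 2 * (C - (a - a')) / 2 * ((a + a') / (a ^ 2 * a' ^ 2))) :=
        mul_le_mul_of_nonneg_left hK (sub_nonneg.2 hle)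
    _ = C ^ 2 * (C - (a - a')) / 2 * ((a - a') * ((a + a') / (a ^ 2 * a' ^ 2))) := by ring

/-! ## §2 The two-term inequality at the scale of maximal discrepancy -/

/-- The forcing `F = γ³∕2·|1∕g_IR² − 1∕g_IR′²| + γ∕(3√3·b)·η` is non-negative (`η ≥ 0` is forced by `hη` at the constant history). [folklore] -/
theorem forcing_nonneg (hγ : 0 < γ) (hb : 0 < b) (hη : ∀ u, SeqBox γ u → |B u - B' u| ≤ η) :
    0 ≤ γ ^ 3 / 2 * |1 / gIR ^ 2 - 1 / gIR' ^ 2| + γ / (3 * Real.sqrt 3 * b) * η := by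
  have hη0 : 0 ≤ η := (abs_nonneg _).trans (hη _ (seqBox_const hγ))
  positivity

/-- **THE TWO-TERM INEQUALITY AT THE MAXIMAL SCALE — NO SIZE CONDITION.**  `B` with zeroth moment `M ≥ 0`, `B` and `B′` with floor `b > 0` on
]0,γ], `|B − B′| ≤ η` on the box, pins `g_IR, g_IR′ ∈ ]0,γ]`, box solutions `h` of `(B, g_IR)` and `h′` of `(B′, g_IR′)`.  Then the discrepancy
`Δ = sup_j |h_j − h′_j|` is attained and satisfies `(1 − q)·Δ + q·Δ²∕γ ≤ F`, `q = M·γ∕(3√3·b)`, `F = γ³∕2·|1∕g_IR² − 1∕g_IR′²| + γ∕(3√3·b)·η`.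
Proof: at the maximal scale `j⋆`, §1 gives `Δ ≤ (1 − Δ∕C)·C³∕2·(|1∕g_IR² − 1∕g_IR′²| + j⋆·(M·Δ + η))` with `C = (1∕γ² + j⋆·b)^{−1∕2} ≤ γ`, and
(E38a)'s `j⋆·C³∕2 ≤ γ∕(3√3·b)`. [folklore] -/
theorem exists_max_two_term
    (hB : ∀ u u' : ℕ → ℝ, SeqBox γ u → SeqBox γ u' → ∀ D : ℝ, (∀ j, |u j - u' j| ≤ D) → |B u - B u'| ≤ M * D)
    (hM : 0 ≤ M) (hgIR : 0 < gIR) (hgIRγ : gIR ≤ γ) (hgIR' : 0 < gIR') (hgIR'γ : gIR' ≤ γ) (hb : 0 < b)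
    (hlo : ∀ u, SeqBox γ u → b ≤ B u) (hlo' : ∀ u, SeqBox γ u → b ≤ B' u)
    (hη : ∀ u, SeqBox γ u → |B u - B' u| ≤ η) (hh : SeqBox γ h) (hh' : SeqBox γ h') (hf : MemFlow B gIR h)
    (hf' : MemFlow B' gIR' h') :
    ∃ Δ : ℝ, 0 ≤ Δ ∧ (∀ j, |h j - h' j| ≤ Δ) ∧
      (1 - M * γ / (3 * Real.sqrt 3 * b)) * Δ + M * γ / (3 * Real.sqrt 3 * b) * Δ ^ 2 / γ
        ≤ γ ^ 3 / 2 * |1 / gIR ^ 2 - 1 / gIR' ^ 2| + γ / (3 * Real.sqrt 3 * b) * η := by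
  have hγ : 0 < γ := lt_of_lt_of_le hgIR hgIRγ
  have hη0 : 0 ≤ η := (abs_nonneg _).trans (hη _ (seqBox_const hγ))
  have hF0 := forcing_nonneg (gIR := gIR) (gIR' := gIR') hγ hb hη
  set δ : ℕ → ℝ := fun j => |h j - h' j| with hδ
  -- the envelopes: both solutions lie below `C_j = (1∕γ² + j·b)^{−1∕2}` at scale `j`
  have henv : ∀ j, h j ≤ 1 / Real.sqrt (1 / γ ^ 2 + (j : ℝ) * b) := fun j => le_envelope_of_memFlow hb hgIR hgIRγ hlo hh hf j
  have henv' : ∀ j, h' j ≤ 1 / Real.sqrt (1 / γ ^ 2 + (j : ℝ) * b) := fun j => le_envelope_of_memFlow hb hgIR' hgIR'γ hlo' hh' hf' j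
  have hδenv : ∀ j, δ j ≤ 1 / Real.sqrt (1 / γ ^ 2 + (j : ℝ) * b) := fun j =>
    abs_sub_le_of_nonneg_of_le (hh j).1.le (henv j) (hh' j).1.le (henv' j)
  by_cases hz : ∀ j, δ j = 0
  · refine ⟨0, le_rfl, fun j => (hz j).le, ?_⟩
    simpa using hF0
  push Not at hz
  obtain ⟨j₀, hj₀⟩ := hz
  have hδ0 : 0 < δ j₀ := lt_of_le_of_ne (abs_nonneg _) (Ne.symm hj₀)
  -- beyond a scale `J` the envelope is below `δ j₀ ∕ 2`
  obtain ⟨J, hJ⟩ := invSqrt_tail_le (γ := γ) hb (half_pos hδ0)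
  have hfar : ∀ j, J ≤ j → δ j < δ j₀ := fun j hj => ((hδenv j).trans (hJ j hj)).trans_lt (half_lt_self hδ0)
  have hj₀J : j₀ < J := not_le.1 fun hle => lt_irrefl _ (hfar j₀ hle)
  -- the supremum is attained on the finite window `j < J`
  obtain ⟨jS, -, hmax⟩ := exists_max_image (range J) δ ⟨j₀, mem_range.2 hj₀J⟩
  have hΔ : ∀ j, δ j ≤ δ jS := fun j => (lt_or_ge j J).elim (fun hj => hmax j (mem_range.2 hj))
    fun hj => (hfar j hj).le.trans (hmax j₀ (mem_range.2 hj₀J))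
  set Δ := δ jS with hΔdef
  have hΔ0 : 0 ≤ Δ := abs_nonneg _
  refine ⟨Δ, hΔ0, hΔ, ?_⟩
  -- the chain at the scale jS
  set a := h jS
  set a' := h' jS
  have ha : 0 < a := (hh jS).1
  have ha' : 0 < a' := (hh' jS).1
  set P : ℝ := 1 / γ ^ 2 + (jS : ℝ) * b with hP
  have hmb : (0 : ℝ) ≤ (jS : ℝ) * b := mul_nonneg (Nat.cast_nonneg jS) hb.le
  set C : ℝ := 1 / Real.sqrt P with hC
  have haC : a ≤ C := henv jS
  have ha'C : a' ≤ C := henv' jS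
  have hC0 : 0 < C := lt_of_lt_of_le ha haC
  have hCγ : C ≤ γ := inv_sqrt_le_of_inv_sq_le hγ (le_add_of_nonneg_right hmb)
  have hΔC : Δ ≤ C := hδenv jS
  have hsens : Δ ≤ C ^ 2 * (C - Δ) / 2 * |1 / a ^ 2 - 1 / a' ^ 2| := abs_sub_le_defect_mul ha ha' haC ha'C
  have hSa : 1 / a ^ 2 = 1 / gIR ^ 2 + drive B h jS := invSq_eq_of_memFlow hf jS
  have hSa' : 1 / a' ^ 2 = 1 / gIR' ^ 2 + drive B' h' jS := invSq_eq_of_memFlow hf' jS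
  have hdiff : |1 / a ^ 2 - 1 / a' ^ 2| ≤ |1 / gIR ^ 2 - 1 / gIR' ^ 2| + (jS : ℝ) * (M * Δ + η) := by
    rw [hSa, hSa']
    calc |1 / gIR ^ 2 + drive B h jS - (1 / gIR' ^ 2 + drive B' h' jS)|
        = |(1 / gIR ^ 2 - 1 / gIR' ^ 2) + (drive B h jS - drive B' h' jS)| := by ring_nf
      _ ≤ |1 / gIR ^ 2 - 1 / gIR' ^ 2| + |drive B h jS - drive B' h' jS| := abs_add_le _ _
      _ ≤ |1 / gIR ^ 2 - 1 / gIR' ^ 2| + (jS : ℝ) * (M * Δ + η) :=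
          add_le_add le_rfl (abs_drive_sub_drive_le_zm hB hη hh hh' hΔ jS)
  have hW1 : C ^ 3 / 2 ≤ γ ^ 3 / 2 := div_le_div_of_nonneg_right (pow_le_pow_left₀ hC0.le hCγ 3) (by norm_num)
  have hW2 : (jS : ℝ) * (C ^ 3 / 2) ≤ γ / (3 * Real.sqrt 3 * b) := weight_sharp_le hγ hb jS
  have hPabs : 0 ≤ |1 / gIR ^ 2 - 1 / gIR' ^ 2| := abs_nonneg _
  have hE0 : 0 ≤ M * Δ + η := by positivity
  -- abbreviations: `G = F + q·Δ`
  set F : ℝ := γ ^ 3 / 2 * |1 / gIR ^ 2 - 1 / gIR' ^ 2| + γ / (3 * Real.sqrt 3 * b) * η with hFdef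
  set q : ℝ := M * γ / (3 * Real.sqrt 3 * b) with hqdef
  have hq0 : 0 ≤ q := by positivity
  have hG : C ^ 3 / 2 * (|1 / gIR ^ 2 - 1 / gIR' ^ 2| + (jS : ℝ) * (M * Δ + η)) ≤ F + q * Δ := by
    calc C ^ 3 / 2 * (|1 / gIR ^ 2 - 1 / gIR' ^ 2| + (jS : ℝ) * (M * Δ + η))
        = C ^ 3 / 2 * |1 / gIR ^ 2 - 1 / gIR' ^ 2| + (jS : ℝ) * (C ^ 3 / 2) * (M * Δ + η) := by ring
      _ ≤ γ ^ 3 / 2 * |1 / gIR ^ 2 - 1 / gIR' ^ 2| + γ / (3 * Real.sqrt 3 * b) * (M * Δ + η) :=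
          add_le_add (mul_le_mul_of_nonneg_right hW1 hPabs) (mul_le_mul_of_nonneg_right hW2 hE0)
      _ = F + q * Δ := by rw [hFdef, hqdef]; ring
  -- `Δ ≤ (1 − Δ∕C)·(F + qΔ)`
  have hfac : 0 ≤ (C - Δ) / C := div_nonneg (sub_nonneg.2 hΔC) hC0.le
  have hstep : Δ ≤ (C - Δ) / C * (F + q * Δ) := by
    calc Δ ≤ C ^ 2 * (C - Δ) / 2 * |1 / a ^ 2 - 1 / a' ^ 2| := hsens
      _ ≤ C ^ 2 * (C - Δ) / 2 * (|1 / gIR ^ 2 - 1 / gIR' ^ 2| + (jS : ℝ) * (M * Δ + η)) :=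
          mul_le_mul_of_nonneg_left hdiff (by have := sub_nonneg.2 hΔC; positivity)
      _ = (C - Δ) / C * (C ^ 3 / 2 * (|1 / gIR ^ 2 - 1 / gIR' ^ 2| + (jS : ℝ) * (M * Δ + η))) := by
          rw [show C ^ 2 * (C - Δ) / 2 = (C - Δ) / C * (C ^ 3 / 2) by field_simp]
          ring
      _ ≤ (C - Δ) / C * (F + q * Δ) := mul_le_mul_of_nonneg_left hG hfac
  -- `(1 − Δ∕C)·(F + qΔ) ≤ F + qΔ − qΔ²∕γ`
  have hquad : (C - Δ) / C * (F + q * Δ) ≤ F + q * Δ - q * Δ ^ 2 / γ := by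
    have e1 : (C - Δ) / C * (F + q * Δ) = F + q * Δ - Δ / C * F - q * Δ ^ 2 / C := by
      field_simp
      ring
    have h1 : 0 ≤ Δ / C * F := mul_nonneg (div_nonneg hΔ0 hC0.le) hF0
    have h2 : q * Δ ^ 2 / γ ≤ q * Δ ^ 2 / C := div_le_div_of_nonneg_left (mul_nonneg hq0 (sq_nonneg Δ)) hC0 hCγ
    rw [e1]
    linarith
  linarith [hstep.trans hquad]

/-- THE QUADRATIC STEP: `q, γ > 0`, `F, m ≥ 0`, `q·Δ²∕γ ≤ F + m·Δ` ⟹ `Δ ≤ γ·m∕q + √(γ·F∕q)` (if `Δ > W + S`, `W = γm∕q`, `S = √(γF∕q)`, then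
`(q∕γ)·Δ·(Δ − W) > (q∕γ)·S² = F`). [folklore] -/
theorem le_of_quadratic_step {q γ' F m Δ : ℝ} (hq : 0 < q) (hγ : 0 < γ') (hF : 0 ≤ F) (hm : 0 ≤ m)
    (hstep : q * Δ ^ 2 / γ' ≤ F + m * Δ) : Δ ≤ γ' * m / q + Real.sqrt (γ' * F / q) := by
  set W : ℝ := γ' * m / q with hW
  set S : ℝ := Real.sqrt (γ' * F / q) with hS
  have hW0 : 0 ≤ W := by positivity
  have hS0 : 0 ≤ S := Real.sqrt_nonneg _
  have hS2 : S ^ 2 = γ' * F / q := Real.sq_sqrt (by positivity)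
  by_contra hcon
  push Not at hcon
  have hΔW : S < Δ - W := by linarith
  have hprod : S * S < Δ * (Δ - W) := mul_lt_mul'' (by linarith) hΔW hS0 hS0
  have e1 : q / γ' * (S * S) = F := by
    rw [← sq, hS2]
    field_simp
  have e2 : q / γ' * (Δ * (Δ - W)) = q * Δ ^ 2 / γ' - m * Δ := by
    rw [hW]
    field_simp
  have := mul_lt_mul_of_pos_left hprod (by positivity : 0 < q / γ')
  rw [e1, e2] at this
  linarith

/-! ## §3 The modulus on the closed range `M·γ ≤ 3√3·b` -/

/-- **THE TWO-TERM MODULUS UNDER THE CLOSED CONDITION**, at every scale: `M·γ ≤ 3√3·b` ⟹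
`(1 − q)·|h_j − h′_j| + q·|h_j − h′_j|²∕γ ≤ γ³∕2·|1∕g_IR² − 1∕g_IR′²| + γ∕(3√3·b)·η`, `q = M·γ∕(3√3·b) ∈ [0,1]`.  Dropping the square gives (E38b)'s
`memFlow_stability_zs` for `q < 1`; dropping the linear term gives the `1∕2`-Hölder bounds below. [folklore] -/
theorem two_term_modulus_zs_closed
    (hB : ∀ u u' : ℕ → ℝ, SeqBox γ u → SeqBox γ u' → ∀ D : ℝ, (∀ j, |u j - u' j| ≤ D) → |B u - B u'| ≤ M * D)
    (hM : 0 ≤ M) (hgIR : 0 < gIR) (hgIRγ : gIR ≤ γ) (hgIR' : 0 < gIR') (hgIR'γ : gIR' ≤ γ) (hb : 0 < b)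
    (hlo : ∀ u, SeqBox γ u → b ≤ B u) (hlo' : ∀ u, SeqBox γ u → b ≤ B' u) (hsmall : M * γ ≤ 3 * Real.sqrt 3 * b)
    (hη : ∀ u, SeqBox γ u → |B u - B' u| ≤ η) (hh : SeqBox γ h) (hh' : SeqBox γ h') (hf : MemFlow B gIR h)
    (hf' : MemFlow B' gIR' h') (j : ℕ) :
    (1 - M * γ / (3 * Real.sqrt 3 * b)) * |h j - h' j| + M * γ / (3 * Real.sqrt 3 * b) * |h j - h' j| ^ 2 / γ
      ≤ γ ^ 3 / 2 * |1 / gIR ^ 2 - 1 / gIR' ^ 2| + γ / (3 * Real.sqrt 3 * b) * η := by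
  have hγ : 0 < γ := lt_of_lt_of_le hgIR hgIRγ
  obtain ⟨Δ, hΔ0, hΔ, hmain⟩ := exists_max_two_term hB hM hgIR hgIRγ hgIR' hgIR'γ hb hlo hlo' hη hh hh' hf hf'
  set q : ℝ := M * γ / (3 * Real.sqrt 3 * b) with hqdef
  have hq0 : 0 ≤ q := by positivity
  have hq1 : q ≤ 1 := by rw [hqdef, div_le_one (by positivity)]; exact hsmall
  have hδ0 : 0 ≤ |h j - h' j| := abs_nonneg _
  have h1 : (1 - q) * |h j - h' j| ≤ (1 - q) * Δ := mul_le_mul_of_nonneg_left (hΔ j) (sub_nonneg.2 hq1)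
  have h2 : q * |h j - h' j| ^ 2 / γ ≤ q * Δ ^ 2 / γ :=
    div_le_div_of_nonneg_right (mul_le_mul_of_nonneg_left (pow_le_pow_left₀ hδ0 (hΔ j) 2) hq0) hγ.le
  linarith

/-- **THE `1∕2`-HÖLDER BOUND** (`0 < M`, `M·γ ≤ 3√3·b`): `|h_j − h′_j| ≤ √((3√3·b∕M)·F)` at every scale — the quadratic term of the two-term
modulus alone (`γ∕q = 3√3·b∕M`). [folklore] -/
theorem abs_sub_le_sqrt_zs_closed
    (hB : ∀ u u' : ℕ → ℝ, SeqBox γ u → SeqBox γ u' → ∀ D : ℝ, (∀ j, |u j - u' j| ≤ D) → |B u - B u'| ≤ M * D)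
    (hM : 0 < M) (hgIR : 0 < gIR) (hgIRγ : gIR ≤ γ) (hgIR' : 0 < gIR') (hgIR'γ : gIR' ≤ γ) (hb : 0 < b)
    (hlo : ∀ u, SeqBox γ u → b ≤ B u) (hlo' : ∀ u, SeqBox γ u → b ≤ B' u) (hsmall : M * γ ≤ 3 * Real.sqrt 3 * b)
    (hη : ∀ u, SeqBox γ u → |B u - B' u| ≤ η) (hh : SeqBox γ h) (hh' : SeqBox γ h') (hf : MemFlow B gIR h)
    (hf' : MemFlow B' gIR' h') (j : ℕ) :
    |h j - h' j| ≤ Real.sqrt (3 * Real.sqrt 3 * b / M *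
      (γ ^ 3 / 2 * |1 / gIR ^ 2 - 1 / gIR' ^ 2| + γ / (3 * Real.sqrt 3 * b) * η)) := by
  have hγ : 0 < γ := lt_of_lt_of_le hgIR hgIRγ
  have hmain := two_term_modulus_zs_closed hB hM.le hgIR hgIRγ hgIR' hgIR'γ hb hlo hlo' hsmall hη hh hh' hf hf' j
  set F : ℝ := γ ^ 3 / 2 * |1 / gIR ^ 2 - 1 / gIR' ^ 2| + γ / (3 * Real.sqrt 3 * b) * η with hFdef
  set q : ℝ := M * γ / (3 * Real.sqrt 3 * b) with hqdef
  have hq0 : 0 < q := by positivity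
  have hq1 : q ≤ 1 := by rw [hqdef, div_le_one (by positivity)]; exact hsmall
  have hstep : q * |h j - h' j| ^ 2 / γ ≤ F + 0 * |h j - h' j| := by
    have : 0 ≤ (1 - q) * |h j - h' j| := mul_nonneg (sub_nonneg.2 hq1) (abs_nonneg _)
    linarith
  have := le_of_quadratic_step hq0 hγ (forcing_nonneg (gIR := gIR) (gIR' := gIR') hγ hb hη) le_rfl hstep
  have e : 3 * Real.sqrt 3 * b / M * F = γ * F / q := by rw [hqdef]; field_simp
  rwa [mul_zero, zero_div, zero_add, ← e] at this

/-- **AT THE THRESHOLD EXACTLY** (`M·γ = 3√3·b`, where (E38b)'s Lipschitz constant is infinite and (E40) had continuity without a rate):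
`|h_j − h′_j| ≤ √(γ·F)` — the box solution depends `1∕2`-HÖLDER on the pin and on the functional, uniformly in the scale. [folklore] -/
theorem abs_sub_le_sqrt_at_threshold
    (hB : ∀ u u' : ℕ → ℝ, SeqBox γ u → SeqBox γ u' → ∀ D : ℝ, (∀ j, |u j - u' j| ≤ D) → |B u - B u'| ≤ M * D)
    (hgIR : 0 < gIR) (hgIRγ : gIR ≤ γ) (hgIR' : 0 < gIR') (hgIR'γ : gIR' ≤ γ) (hb : 0 < b)
    (hlo : ∀ u, SeqBox γ u → b ≤ B u) (hlo' : ∀ u, SeqBox γ u → b ≤ B' u) (hcrit : M * γ = 3 * Real.sqrt 3 * b)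
    (hη : ∀ u, SeqBox γ u → |B u - B' u| ≤ η) (hh : SeqBox γ h) (hh' : SeqBox γ h') (hf : MemFlow B gIR h)
    (hf' : MemFlow B' gIR' h') (j : ℕ) :
    |h j - h' j| ≤ Real.sqrt (γ * (γ ^ 3 / 2 * |1 / gIR ^ 2 - 1 / gIR' ^ 2| + γ / (3 * Real.sqrt 3 * b) * η)) := by
  have hγ : 0 < γ := lt_of_lt_of_le hgIR hgIRγ
  have hM : 0 < M := by
    by_contra hM
    linarith [mul_nonpos_of_nonpos_of_nonneg (not_lt.1 hM) hγ.le, (by positivity : (0 : ℝ) < 3 * Real.sqrt 3 * b)]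
  have e : 3 * Real.sqrt 3 * b / M = γ := by
    rw [div_eq_iff hM.ne', ← hcrit, mul_comm]
  have := abs_sub_le_sqrt_zs_closed hB hM hgIR hgIRγ hgIR' hgIR'γ hb hlo hlo' hcrit.le hη hh hh' hf hf' j
  rwa [e] at this

/-- **THE TWO-REGIME BOUND, UNIFORM ON THE CLOSED RANGE** (`M ≥ 0`, `M·γ ≤ 3√3·b`): `|h_j − h′_j| ≤ 2F + √(2γF)` — `q ≤ 1∕2`: the linear term
gives `2F`; `q ≥ 1∕2`: the quadratic term gives `√(2γF)`. [folklore] -/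
theorem abs_sub_le_two_regime
    (hB : ∀ u u' : ℕ → ℝ, SeqBox γ u → SeqBox γ u' → ∀ D : ℝ, (∀ j, |u j - u' j| ≤ D) → |B u - B u'| ≤ M * D)
    (hM : 0 ≤ M) (hgIR : 0 < gIR) (hgIRγ : gIR ≤ γ) (hgIR' : 0 < gIR') (hgIR'γ : gIR' ≤ γ) (hb : 0 < b)
    (hlo : ∀ u, SeqBox γ u → b ≤ B u) (hlo' : ∀ u, SeqBox γ u → b ≤ B' u) (hsmall : M * γ ≤ 3 * Real.sqrt 3 * b)
    (hη : ∀ u, SeqBox γ u → |B u - B' u| ≤ η) (hh : SeqBox γ h) (hh' : SeqBox γ h') (hf : MemFlow B gIR h)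
    (hf' : MemFlow B' gIR' h') (j : ℕ) :
    |h j - h' j| ≤ 2 * (γ ^ 3 / 2 * |1 / gIR ^ 2 - 1 / gIR' ^ 2| + γ / (3 * Real.sqrt 3 * b) * η)
      + Real.sqrt (2 * γ * (γ ^ 3 / 2 * |1 / gIR ^ 2 - 1 / gIR' ^ 2| + γ / (3 * Real.sqrt 3 * b) * η)) := by
  have hγ : 0 < γ := lt_of_lt_of_le hgIR hgIRγ
  have hmain := two_term_modulus_zs_closed hB hM hgIR hgIRγ hgIR' hgIR'γ hb hlo hlo' hsmall hη hh hh' hf hf' j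
  have hF0 := forcing_nonneg (gIR := gIR) (gIR' := gIR') hγ hb hη
  set F : ℝ := γ ^ 3 / 2 * |1 / gIR ^ 2 - 1 / gIR' ^ 2| + γ / (3 * Real.sqrt 3 * b) * η with hFdef
  set q : ℝ := M * γ / (3 * Real.sqrt 3 * b) with hqdef
  set d : ℝ := |h j - h' j| with hddef
  have hq1 : q ≤ 1 := by rw [hqdef, div_le_one (by positivity)]; exact hsmall
  have hd0 : 0 ≤ d := abs_nonneg _
  have hs0 : 0 ≤ Real.sqrt (2 * γ * F) := Real.sqrt_nonneg _
  have hquad0 : 0 ≤ q * d ^ 2 / γ := by positivity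
  rcases le_total q (1 / 2) with hq | hq
  · -- linear regime: `d∕2 ≤ (1 − q)·d ≤ F`
    have h1 : d / 2 ≤ (1 - q) * d := by nlinarith
    linarith
  · -- quadratic regime: the quadratic step with `m = 0`, then `γF∕q ≤ 2γF`
    have hstep : q * d ^ 2 / γ ≤ F + 0 * d := by nlinarith
    have h1 := le_of_quadratic_step (by linarith) hγ hF0 le_rfl hstep
    have h2 : Real.sqrt (γ * F / q) ≤ Real.sqrt (2 * γ * F) :=
      Real.sqrt_le_sqrt (by
        rw [div_le_iff₀ (by linarith)]
        nlinarith [mul_nonneg (mul_nonneg hγ.le hF0) (by linarith : (0 : ℝ) ≤ 2 * q - 1)])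
    rw [mul_zero, zero_div, zero_add] at h1
    linarith

/-! ## §4 Every ratio: the width of the solution set above the threshold, one modulus of upper semicontinuity -/

/-- **ONE MODULUS OF UPPER SEMICONTINUITY FOR EVERY RATIO** (`M > 0`, any size): two box solutions of `(B, g_IR)` and `(B′, g_IR′)` as in §2 satisfy
`|h_j − h′_j| ≤ γ·max(1 − 3√3·b∕(M·γ), 0) + √((3√3·b∕M)·F)` at every scale — the square root alone below the threshold (§3 `abs_sub_le_sqrt_zs_closed`),
the width `γ(1 − 1∕q)` plus the same square root above it: (E40)'s upper semicontinuity of the solution set, quantified at every ratio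
(`q·Δ²∕γ ≤ F + (q − 1)₊·Δ` and the quadratic step). [folklore] -/
theorem abs_sub_le_usc_modulus
    (hB : ∀ u u' : ℕ → ℝ, SeqBox γ u → SeqBox γ u' → ∀ D : ℝ, (∀ j, |u j - u' j| ≤ D) → |B u - B u'| ≤ M * D)
    (hM : 0 < M) (hgIR : 0 < gIR) (hgIRγ : gIR ≤ γ) (hgIR' : 0 < gIR') (hgIR'γ : gIR' ≤ γ) (hb : 0 < b)
    (hlo : ∀ u, SeqBox γ u → b ≤ B u) (hlo' : ∀ u, SeqBox γ u → b ≤ B' u)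
    (hη : ∀ u, SeqBox γ u → |B u - B' u| ≤ η) (hh : SeqBox γ h) (hh' : SeqBox γ h') (hf : MemFlow B gIR h)
    (hf' : MemFlow B' gIR' h') (j : ℕ) :
    |h j - h' j| ≤ γ * max (1 - 3 * Real.sqrt 3 * b / (M * γ)) 0 + Real.sqrt (3 * Real.sqrt 3 * b / M *
      (γ ^ 3 / 2 * |1 / gIR ^ 2 - 1 / gIR' ^ 2| + γ / (3 * Real.sqrt 3 * b) * η)) := by
  have hγ : 0 < γ := lt_of_lt_of_le hgIR hgIRγ
  have h33 : 0 < 3 * Real.sqrt 3 * b := by positivity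
  rcases le_total (3 * Real.sqrt 3 * b) (M * γ) with hge | hle
  · -- at or above the threshold: `q ≥ 1`, `m = q − 1` in the quadratic step
    have hF0 := forcing_nonneg (gIR := gIR) (gIR' := gIR') hγ hb hη
    obtain ⟨Δ, hΔ0, hΔ, hmain⟩ := exists_max_two_term hB hM.le hgIR hgIRγ hgIR' hgIR'γ hb hlo hlo' hη hh hh' hf hf'
    set F : ℝ := γ ^ 3 / 2 * |1 / gIR ^ 2 - 1 / gIR' ^ 2| + γ / (3 * Real.sqrt 3 * b) * η with hFdef
    set q : ℝ := M * γ / (3 * Real.sqrt 3 * b) with hqdef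
    have hq0 : 0 < q := by positivity
    have hq1 : 1 ≤ q := by rw [hqdef, le_div_iff₀ h33]; linarith
    have hw : 0 ≤ 1 - 3 * Real.sqrt 3 * b / (M * γ) := by
      rw [sub_nonneg, div_le_one (by positivity)]; exact hge
    rw [max_eq_left hw]
    have hstep : q * Δ ^ 2 / γ ≤ F + (q - 1) * Δ := by linarith
    have := le_of_quadratic_step hq0 hγ hF0 (by linarith) hstep
    have e1 : γ * (1 - 3 * Real.sqrt 3 * b / (M * γ)) = γ * (q - 1) / q := by
      rw [hqdef]
      field_simp
    have e2 : 3 * Real.sqrt 3 * b / M * F = γ * F / q := by rw [hqdef]; field_simp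
    rw [e1, e2]
    exact (hΔ j).trans this
  · -- below the threshold: the square root alone (§3)
    have hw : 1 - 3 * Real.sqrt 3 * b / (M * γ) ≤ 0 := by
      rw [sub_nonpos, one_le_div (by positivity)]; exact hle
    rw [max_eq_right hw, mul_zero, zero_add]
    exact abs_sub_le_sqrt_zs_closed hB hM hgIR hgIRγ hgIR' hgIR'γ hb hlo hlo' hle hη hh hh' hf hf' j

/-- **THE WIDTH OF THE SOLUTION SET ABOVE THE THRESHOLD.**  `M·γ ≥ 3√3·b` (`q ≥ 1`), ONE flow, two box solutions from one pin:
`|h_j − h′_j| ≤ γ·(1 − 3√3·b∕(M·γ)) = γ(1 − 1∕q)` at every scale — §2's inequality with `F = 0` reads `q·Δ²∕γ ≤ (q − 1)·Δ`.  The compact line set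
of (E44) has sup-diameter `≤ γ(1 − 1∕q)`: non-uniqueness switches on CONTINUOUSLY at `3√3`, at most linearly in the ratio (linear IS the order of
(E38c)'s tent and (E45a)'s clamp: width `(1 − y)∕√3` at `1 − 1∕q ≍ 1 − y`); at `q = 1` it is (E38a)'s uniqueness again. [folklore] -/
theorem abs_sub_le_width_above
    (hB : ∀ u u' : ℕ → ℝ, SeqBox γ u → SeqBox γ u' → ∀ D : ℝ, (∀ j, |u j - u' j| ≤ D) → |B u - B u'| ≤ M * D)
    (hgIR : 0 < gIR) (hgIRγ : gIR ≤ γ) (hb : 0 < b) (hlo : ∀ u, SeqBox γ u → b ≤ B u) (hlarge : 3 * Real.sqrt 3 * b ≤ M * γ)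
    (hh : SeqBox γ h) (hh' : SeqBox γ h') (hf : MemFlow B gIR h) (hf' : MemFlow B gIR h') (j : ℕ) :
    |h j - h' j| ≤ γ * (1 - 3 * Real.sqrt 3 * b / (M * γ)) := by
  have hγ : 0 < γ := lt_of_lt_of_le hgIR hgIRγ
  have hMγ : 0 < M * γ := (by positivity : 0 < 3 * Real.sqrt 3 * b).trans_le hlarge
  have hM : 0 < M := pos_of_mul_pos_left hMγ hγ.le
  have h0 : ∀ u, SeqBox γ u → |B u - B u| ≤ 0 := fun u _ => by simp
  have hw : 0 ≤ 1 - 3 * Real.sqrt 3 * b / (M * γ) := by rw [sub_nonneg, div_le_one hMγ]; exact hlarge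
  have := abs_sub_le_usc_modulus hB hM hgIR hgIRγ hgIR hgIRγ hb hlo hlo h0 hh hh' hf hf' j
  simpa only [sub_self, abs_zero, mul_zero, add_zero, Real.sqrt_zero, max_eq_left hw] using this

end Summit.QuantumFields.BalabanUV.Beta.EriceRemainderEnclosureHistoryAutonomyThresholdModulus

end
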